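import Mathlib
import HarnessLib
import Summits.Ventures.LatticeQCDFlow.Exactness.SUNStoutLayerEquivariance
import Summits.Ventures.LatticeQCDFlow.Exactness.SUNResidualCouplingLayer

/-!
# The masked `SU(N)` stout layer on the periodic lattice is a coupling layer with frozen staples, hence a homeomorphism of configuration space for `2(d−1)|ρ| < 1` — every `N`, `d`, `L`, for the engine's masks

HONEST FRAMING: exact (Metropolis-corrected) sampling algorithms for lattice gauge theory;
figures of merit are autocorrelation/cost numbers at stated couplings and volumes; no
continuum-physics claim.

Venture `LatticeQCDFlow` (cell pub-lqcd), topic `Exactness`; FANOUT row 10 (`eng-equiv`, engine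
`latflow.equiv`: `residual.py` stout layers "`U_l → exp(Q_l(U_l)) U_l` on ACTIVE links
(direction coupling + site mask; all staples must consist of frozen links)", "Pure stout: kappa =
J|rho|, J = 2(D−1)"; `masks.py` direction masks "phase(x) = Σ_ν shifts[ν]·x_ν mod width";
`flows_jax.layers` / `residual_flow`).  NEW WORK of the cell over `SUNStoutLayerEquivariance.lean`
(gen 6: the lattice layer `V(x,μ) ↦ exp(ρ(V,(x,μ)) • P(Ω_{x,μ}(V))) V(x,μ)`, gauge equivariant),
`SUNResidualLayerEquiv.lean` (coupling layers with contractive exponential fibres are bijections /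
homeomorphisms / measurable equivalences), `KernelCouplingMask.lean` (direction masks) and the
tree's `WilsonFlow.lean` (`plaquetteLoopSum`); nothing is cited as a fact; no number; no
definition is introduced.  Printed counterparts, NAMED ONLY: Lüscher, CMP 293 (2010) 899,
App. C (C.3) and App. D; Abbott et al., arXiv:2305.02402 §4.2, App. 8 (masking patterns).

## What is typed (`n`, `d`, `L` arbitrary)

* **`plaquetteLoopSum_eq_link_mul`** — Lüscher's (C.3) on the periodic lattice: the loop sum
  through a link is the link times its staple sum,
  `Ω_{x,μ}(V) = V(x,μ) · Σ_{ν≠μ} [V(x+μ̂,ν)V(x+ν̂,μ)⁻¹V(x,ν)⁻¹ + V(x+μ̂−ν̂,ν)⁻¹V(x−ν̂,μ)⁻¹V(x−ν̂,ν)]`;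
* **`sunStoutLayer_eq_coupleFun`** — THE BRIDGE: if at every active link `(x, μ)` the six staple
  links `(x+μ̂,ν)`, `(x+ν̂,μ)`, `(x,ν)`, `(x+μ̂−ν̂,ν)`, `(x−ν̂,μ)`, `(x−ν̂,ν)` (`ν ≠ μ`) are frozen and
  the coefficient reads frozen links only, the masked stout layer IS `Theory2.coupleFun p ψ` with
  the one-link fibres `u ↦ exp(ρ • P(u S)) u`, `S` the staple sum read off the frozen links;
* `frobNorm_stoutFibreExponent_sub_le` — that fibre's exponent is `2(d−1)|ρ|`-Lipschitz in the
  Frobenius norm (`2(d−1)` unitary staples); `continuous_stoutFibreExponent`;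
* **`sunStoutLatticeLayer_bijective`**, **`isHomeomorph_sunStoutLatticeLayer`**,
  **`exists_measurableEquiv_sunStoutLatticeLayer`** — under the frozen-staple hypotheses and
  `2(d−1)|ρ| < 1` at every active link (coefficients continuous in the frozen links), the masked
  `SU(n)` stout layer is a bijection, a homeomorphism and a measurable equivalence of
  `GaugeConfig d L SU(n)` — the engine's `|ρ| < 1/2, 1/4, 1/6` for `d = 2, 3, 4`;
* `directionMask_staples_frozen` — the engine's direction masks `p (x,μ') ↔ μ' = μ ∧ φ x = c`
  meet the six hypotheses as soon as the additive phase moves along EVERY other direction,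
  `φ(ν̂) ≠ 0` for all `ν ≠ μ` (generalized checkerboard: all shifts nonzero mod width; plain
  stripes do NOT qualify for stout layers — their `μ`-links at `x ± ν̂` off the stripe direction
  stay active).

NOT here: the layer's Jacobian; any number.
-/

noncomputable section

namespace Summit.Ventures.LatticeQCDFlow.Exactness

open Matrix
open Literature.MathematicalPhysics.QuantumFieldTheory
open Literature.MathematicalPhysics.QuantumFieldTheory.Luscher2010
open scoped Matrix

variable {d L n : ℕ}

/-! ## Lüscher (C.3): the loop sum is the link times the staple sum -/

/-- **`Ω_{x,μ}(V) = V(x,μ) · (staple sum)`** on the periodic lattice, for `SU(n)` configurations: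
the upper plaquette in the plane `(μ, ν)` is `V(x,μ)` times `V(x+μ̂,ν) V(x+ν̂,μ)⁻¹ V(x,ν)⁻¹`, the
lower one (conjugated to start at `x`) is `V(x,μ)` times `V(x−ν̂+μ̂,ν)⁻¹ V(x−ν̂,μ)⁻¹ V(x−ν̂,ν)`. -/
theorem plaquetteLoopSum_eq_link_mul (V : GaugeConfig d L (Matrix.specialUnitaryGroup (Fin n) ℂ))
    (x : Site d L) (μ : Fin d) :
    plaquetteLoopSum V x μ = ((V (x, μ) : Matrix.specialUnitaryGroup (Fin n) ℂ) : Matrix (Fin n) (Fin n) ℂ) *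
      ∑ ν : Fin d, if ν = μ then (0 : Matrix (Fin n) (Fin n) ℂ) else
        (((V (x.shift μ, ν) * (V (x.shift ν, μ))⁻¹ * (V (x, ν))⁻¹ : Matrix.specialUnitaryGroup (Fin n) ℂ) :
            Matrix (Fin n) (Fin n) ℂ) +
          (((V ((x - Pi.single ν 1).shift μ, ν))⁻¹ * (V (x - Pi.single ν 1, μ))⁻¹ * V (x - Pi.single ν 1, ν) :
            Matrix.specialUnitaryGroup (Fin n) ℂ) : Matrix (Fin n) (Fin n) ℂ)) := by
  unfold plaquetteLoopSum
  rw [Finset.mul_sum]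
  refine Finset.sum_congr rfl fun ν _ => ?_
  split_ifs with hν
  · rw [Matrix.mul_zero]
  · have hup : plaquetteHolonomy V x μ ν = V (x, μ) * (V (x.shift μ, ν) * (V (x.shift ν, μ))⁻¹ * (V (x, ν))⁻¹) :=
      (link_mul_plaquetteStaple V x μ ν).symm
    have hdown : (V (x - Pi.single ν 1, ν))⁻¹ * plaquetteHolonomy V (x - Pi.single ν 1) ν μ * V (x - Pi.single ν 1, ν) =
        V (x, μ) * ((V ((x - Pi.single ν 1).shift μ, ν))⁻¹ * (V (x - Pi.single ν 1, μ))⁻¹ * V (x - Pi.single ν 1, ν)) := by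
      unfold plaquetteHolonomy
      rw [shift_sub_single]
      group
    rw [hup, hdown, Matrix.mul_add]
    rfl

/-- `r • P(W)` is skew-Hermitian and traceless (real `r`): the stout fibre's exponent lies in
`𝔰𝔲(n)`. -/
theorem smul_suProj_skew (r : ℝ) (W : Matrix (Fin n) (Fin n) ℂ) :
    ((r : ℂ) • suProj W)ᴴ = -((r : ℂ) • suProj W) ∧ ((r : ℂ) • suProj W).trace = 0 := by
  refine ⟨?_, ?_⟩
  · rw [Matrix.conjTranspose_smul, conjTranspose_suProj, Complex.star_def, Complex.conj_ofReal, smul_neg]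
  · rw [Matrix.trace_smul, trace_suProj, smul_zero]

/-! ## The bridge: frozen staples + frozen coefficient ⟹ the stout layer is a coupling layer -/

/-- **The masked `SU(n)` stout layer is a coupling layer.**  Hypotheses: at every active link
`e = (x, μ)` and every `ν ≠ μ`, the six staple links are frozen (`h1`–`h6`), and the coefficient
`ρ V e = R e (V|frozen)` reads frozen links (`hR`).  Conclusion: the layer of
`isGaugeEquivariant_sunStoutLayer` equals `Theory2.coupleFun p ψ`, `ψ ⟨e,_⟩ y u =
exp(R e y • P(u · S_e(y))) · u`, with the staple sum `S_e(y)` read off the frozen links `y`. -/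
theorem sunStoutLayer_eq_coupleFun (p : Edge d L → Prop) [DecidablePred p]
    (ρ : GaugeConfig d L (Matrix.specialUnitaryGroup (Fin n) ℂ) → Edge d L → ℝ)
    (R : (e : Edge d L) → ({f : Edge d L // ¬p f} → Matrix.specialUnitaryGroup (Fin n) ℂ) → ℝ)
    (hR : ∀ V e, p e → ρ V e = R e (fun f => V f))
    (h1 : ∀ e, p e → ∀ ν, ν ≠ e.2 → ¬p (e.1.shift e.2, ν))
    (h2 : ∀ e, p e → ∀ ν, ν ≠ e.2 → ¬p (e.1.shift ν, e.2))
    (h3 : ∀ e, p e → ∀ ν, ν ≠ e.2 → ¬p (e.1, ν))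
    (h4 : ∀ e, p e → ∀ ν, ν ≠ e.2 → ¬p ((e.1 - Pi.single ν 1).shift e.2, ν))
    (h5 : ∀ e, p e → ∀ ν, ν ≠ e.2 → ¬p (e.1 - Pi.single ν 1, e.2))
    (h6 : ∀ e, p e → ∀ ν, ν ≠ e.2 → ¬p (e.1 - Pi.single ν 1, ν)) :
    (fun (V : GaugeConfig d L (Matrix.specialUnitaryGroup (Fin n) ℂ)) (e : Edge d L) =>
      if p e then
        (⟨NormedSpace.exp ((ρ V e : ℂ) • suProj (plaquetteLoopSum V e.1 e.2)),
            exp_smul_suProj_mem (ρ V e) (plaquetteLoopSum V e.1 e.2)⟩ :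
          Matrix.specialUnitaryGroup (Fin n) ℂ) * V e
      else V e) =
    Theory2.coupleFun p (fun a y (u : Matrix.specialUnitaryGroup (Fin n) ℂ) =>
      (⟨NormedSpace.exp ((R a.1 y : ℂ) • suProj ((u : Matrix (Fin n) (Fin n) ℂ) *
          ∑ ν : Fin d, if hν : ν = a.1.2 then (0 : Matrix (Fin n) (Fin n) ℂ) else
            (((y ⟨_, h1 a.1 a.2 ν hν⟩ * (y ⟨_, h2 a.1 a.2 ν hν⟩)⁻¹ * (y ⟨_, h3 a.1 a.2 ν hν⟩)⁻¹ :
                Matrix.specialUnitaryGroup (Fin n) ℂ) : Matrix (Fin n) (Fin n) ℂ) +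
              (((y ⟨_, h4 a.1 a.2 ν hν⟩)⁻¹ * (y ⟨_, h5 a.1 a.2 ν hν⟩)⁻¹ * y ⟨_, h6 a.1 a.2 ν hν⟩ :
                Matrix.specialUnitaryGroup (Fin n) ℂ) : Matrix (Fin n) (Fin n) ℂ)))),
        exp_smul_suProj_mem _ _⟩ : Matrix.specialUnitaryGroup (Fin n) ℂ) * u) := by
  funext V e
  by_cases he : p e
  · rw [if_pos he, Theory2.coupleFun_apply_of_pos _ _ he]
    have hstaple : plaquetteLoopSum V e.1 e.2 =
        ((V e : Matrix.specialUnitaryGroup (Fin n) ℂ) : Matrix (Fin n) (Fin n) ℂ) *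
          ∑ ν : Fin d, if hν : ν = e.2 then (0 : Matrix (Fin n) (Fin n) ℂ) else
            ((((fun f : {f : Edge d L // ¬p f} => V f) ⟨_, h1 e he ν hν⟩ *
                ((fun f : {f : Edge d L // ¬p f} => V f) ⟨_, h2 e he ν hν⟩)⁻¹ *
                ((fun f : {f : Edge d L // ¬p f} => V f) ⟨_, h3 e he ν hν⟩)⁻¹ :
                Matrix.specialUnitaryGroup (Fin n) ℂ) : Matrix (Fin n) (Fin n) ℂ) +
              ((((fun f : {f : Edge d L // ¬p f} => V f) ⟨_, h4 e he ν hν⟩)⁻¹ *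
                ((fun f : {f : Edge d L // ¬p f} => V f) ⟨_, h5 e he ν hν⟩)⁻¹ *
                (fun f : {f : Edge d L // ¬p f} => V f) ⟨_, h6 e he ν hν⟩ :
                Matrix.specialUnitaryGroup (Fin n) ℂ) : Matrix (Fin n) (Fin n) ℂ)) := by
      rw [plaquetteLoopSum_eq_link_mul V e.1 e.2]
      congr 1
    apply congrArg (· * V e)
    apply Subtype.ext
    change NormedSpace.exp ((ρ V e : ℂ) • suProj (plaquetteLoopSum V e.1 e.2)) = _
    rw [hR V e he, hstaple]
  · rw [if_neg he, Theory2.coupleFun_apply_of_neg _ _ he]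

/-! ## The fibre: exponent `r • P(u S)` with `S` a sum of `2(d−1)` unitary staples -/

/-- **The stout fibre's exponent is `2(d−1)|r|`-Lipschitz** in the Frobenius norm: with
`S = Σ_{ν≠μ} (A_ν + B_ν)`, `A_ν, B_ν` unitary (any `U, V`),
`‖r P(U S) − r P(V S)‖_F ≤ |r| Σ_{ν≠μ} (‖(U−V)A_ν‖_F + ‖(U−V)B_ν‖_F) = 2(d−1)|r| ‖U − V‖_F`. -/
theorem frobNorm_stoutFibreExponent_sub_le (r : ℝ) (μ : Fin d)
    {A B : (ν : Fin d) → ν ≠ μ → Matrix (Fin n) (Fin n) ℂ}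
    (hA : ∀ ν hν, A ν hν ∈ Matrix.unitaryGroup (Fin n) ℂ)
    (hB : ∀ ν hν, B ν hν ∈ Matrix.unitaryGroup (Fin n) ℂ) (U V : Matrix (Fin n) (Fin n) ℂ) :
    frobNorm ((r : ℂ) • suProj (U * ∑ ν, if hν : ν = μ then (0 : Matrix (Fin n) (Fin n) ℂ) else (A ν hν + B ν hν)) -
        (r : ℂ) • suProj (V * ∑ ν, if hν : ν = μ then (0 : Matrix (Fin n) (Fin n) ℂ) else (A ν hν + B ν hν))) ≤
      2 * (d - 1) * |r| * frobNorm (U - V) := by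
  rw [← smul_sub, ← suProj_sub, ← Matrix.sub_mul, frobNorm_smul, Complex.norm_real, Real.norm_eq_abs,
    Finset.mul_sum]
  have hterm : ∀ ν : Fin d,
      frobNorm ((U - V) * (if hν : ν = μ then (0 : Matrix (Fin n) (Fin n) ℂ) else (A ν hν + B ν hν))) ≤
        if ν = μ then (0 : ℝ) else 2 * frobNorm (U - V) := by
    intro ν
    split_ifs with hν
    · rw [Matrix.mul_zero, frobNorm_zero]
    · rw [Matrix.mul_add]
      calc frobNorm ((U - V) * A ν hν + (U - V) * B ν hν)
            ≤ frobNorm ((U - V) * A ν hν) + frobNorm ((U - V) * B ν hν) := frobNorm_add_le _ _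
        _ = 2 * frobNorm (U - V) := by
            rw [frobNorm_mul_unitary _ (hA ν hν), frobNorm_mul_unitary _ (hB ν hν)]; ring
  have hsum : ∑ ν : Fin d, (if ν = μ then (0 : ℝ) else 2 * frobNorm (U - V)) =
      (d - 1) * (2 * frobNorm (U - V)) := by
    rw [Finset.sum_ite, Finset.sum_const_zero, zero_add, Finset.sum_const, nsmul_eq_mul]
    congr 1
    have hfilter : (Finset.univ.filter fun ν : Fin d => ¬ν = μ) = Finset.univ.erase μ := by
      ext ν
      simp [Finset.mem_erase]
    rw [hfilter, Finset.card_erase_of_mem (Finset.mem_univ μ), Finset.card_univ, Fintype.card_fin,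
      Nat.cast_sub (Fin.pos μ), Nat.cast_one]
  calc |r| * frobNorm (suProj (∑ ν, (U - V) *
          (if hν : ν = μ then (0 : Matrix (Fin n) (Fin n) ℂ) else (A ν hν + B ν hν))))
      ≤ |r| * frobNorm (∑ ν, (U - V) *
          (if hν : ν = μ then (0 : Matrix (Fin n) (Fin n) ℂ) else (A ν hν + B ν hν))) :=
        mul_le_mul_of_nonneg_left (frobNorm_suProj_le _) (abs_nonneg r)
    _ ≤ |r| * ∑ ν, frobNorm ((U - V) *
          (if hν : ν = μ then (0 : Matrix (Fin n) (Fin n) ℂ) else (A ν hν + B ν hν))) :=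
        mul_le_mul_of_nonneg_left (frobNorm_sum_le _ _) (abs_nonneg r)
    _ ≤ |r| * ∑ ν : Fin d, (if ν = μ then (0 : ℝ) else 2 * frobNorm (U - V)) :=
        mul_le_mul_of_nonneg_left (Finset.sum_le_sum fun ν _ => hterm ν) (abs_nonneg r)
    _ = 2 * (d - 1) * |r| * frobNorm (U - V) := by rw [hsum]; ring

/-- **The stout fibre's exponent is jointly continuous in (link, frozen context)** when the
coefficient `R` is continuous in the frozen links: the staples are finite products of frozen
links and their inverses. -/
theorem continuous_stoutFibreExponent {Y : Type*} [TopologicalSpace Y] (μ : Fin d) {R : Y → ℝ}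
    (hR : Continuous R) {A B : (ν : Fin d) → ν ≠ μ → Y → Matrix (Fin n) (Fin n) ℂ}
    (hA : ∀ ν hν, Continuous (A ν hν)) (hB : ∀ ν hν, Continuous (B ν hν)) :
    Continuous fun q : Matrix.specialUnitaryGroup (Fin n) ℂ × Y =>
      (R q.2 : ℂ) • suProj ((q.1 : Matrix (Fin n) (Fin n) ℂ) *
        ∑ ν, if hν : ν = μ then (0 : Matrix (Fin n) (Fin n) ℂ) else (A ν hν q.2 + B ν hν q.2)) := by
  have hS : Continuous fun y : Y =>
      ∑ ν, if hν : ν = μ then (0 : Matrix (Fin n) (Fin n) ℂ) else (A ν hν y + B ν hν y) := by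
    refine continuous_finsetSum _ fun ν _ => ?_
    by_cases hν : ν = μ
    · simp only [dif_pos hν]
      exact continuous_const
    · simp only [dif_neg hν]
      exact (hA ν hν).add (hB ν hν)
  exact (Complex.continuous_ofReal.comp (hR.comp continuous_snd)).smul
    (continuous_suProj.comp ((continuous_subtype_val.comp continuous_fst).mul (hS.comp continuous_snd)))

/-- **The stout fibre is a bijection of `SU(n)` for `2(d−1)|r| < 1`** (`residualLayer_bijective`
with the exponent `W ↦ r • P(W S)`; product form `⟨exp(r P(u S)), _⟩ · u` of the lattice layer). -/
theorem stoutFibre_bijective (r : ℝ) (μ : Fin d)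
    {A B : (ν : Fin d) → ν ≠ μ → Matrix (Fin n) (Fin n) ℂ}
    (hA : ∀ ν hν, A ν hν ∈ Matrix.unitaryGroup (Fin n) ℂ)
    (hB : ∀ ν hν, B ν hν ∈ Matrix.unitaryGroup (Fin n) ℂ) (hr : 2 * (d - 1 : ℝ) * |r| < 1) :
    Function.Bijective fun u : Matrix.specialUnitaryGroup (Fin n) ℂ =>
      (⟨NormedSpace.exp ((r : ℂ) • suProj ((u : Matrix (Fin n) (Fin n) ℂ) *
          ∑ ν, if hν : ν = μ then (0 : Matrix (Fin n) (Fin n) ℂ) else (A ν hν + B ν hν))),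
        exp_smul_suProj_mem _ _⟩ : Matrix.specialUnitaryGroup (Fin n) ℂ) * u := by
  have hd : (0 : ℝ) ≤ 2 * (d - 1) := by
    have : (1 : ℝ) ≤ d := by exact_mod_cast Fin.pos μ
    linarith
  have key := residualLayer_bijective (n := n)
    (Q := fun W => (r : ℂ) • suProj (W * ∑ ν, if hν : ν = μ then (0 : Matrix (Fin n) (Fin n) ℂ) else (A ν hν + B ν hν)))
    (mul_nonneg hd (abs_nonneg r)) hr (fun W _ => smul_suProj_skew r _)
    (fun U _ V _ => frobNorm_stoutFibreExponent_sub_le r μ hA hB U V)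
  exact key

/-- **The stout fibre is jointly continuous in (link, frozen context)** (product form). -/
theorem continuous_stoutFibre {Y : Type*} [TopologicalSpace Y] (μ : Fin d) {R : Y → ℝ}
    (hR : Continuous R) {A B : (ν : Fin d) → ν ≠ μ → Y → Matrix (Fin n) (Fin n) ℂ}
    (hA : ∀ ν hν, Continuous (A ν hν)) (hB : ∀ ν hν, Continuous (B ν hν)) :
    Continuous fun q : Matrix.specialUnitaryGroup (Fin n) ℂ × Y =>
      (⟨NormedSpace.exp ((R q.2 : ℂ) • suProj ((q.1 : Matrix (Fin n) (Fin n) ℂ) *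
          ∑ ν, if hν : ν = μ then (0 : Matrix (Fin n) (Fin n) ℂ) else (A ν hν q.2 + B ν hν q.2))),
        exp_smul_suProj_mem _ _⟩ : Matrix.specialUnitaryGroup (Fin n) ℂ) * q.1 :=
  ((continuous_matrix_exp.comp (continuous_stoutFibreExponent μ hR hA hB)).subtype_mk _).mul
    continuous_fst

/-! ## The masked stout layer: bijection, homeomorphism, measurable equivalence -/

/-- The upper staple `y(f₁) y(f₂)⁻¹ y(f₃)⁻¹` depends continuously on the frozen configuration. -/
theorem continuous_frozenStapleUp (p : Edge d L → Prop) (f1 f2 f3 : {f : Edge d L // ¬p f}) :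
    Continuous fun y : {f : Edge d L // ¬p f} → Matrix.specialUnitaryGroup (Fin n) ℂ =>
      ((y f1 * (y f2)⁻¹ * (y f3)⁻¹ : Matrix.specialUnitaryGroup (Fin n) ℂ) : Matrix (Fin n) (Fin n) ℂ) :=
  continuous_subtype_val.comp
    (((continuous_apply f1).mul (continuous_apply f2).inv).mul (continuous_apply f3).inv)

/-- The lower staple `y(f₄)⁻¹ y(f₅)⁻¹ y(f₆)` depends continuously on the frozen configuration. -/
theorem continuous_frozenStapleDown (p : Edge d L → Prop) (f4 f5 f6 : {f : Edge d L // ¬p f}) :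
    Continuous fun y : {f : Edge d L // ¬p f} → Matrix.specialUnitaryGroup (Fin n) ℂ =>
      (((y f4)⁻¹ * (y f5)⁻¹ * y f6 : Matrix.specialUnitaryGroup (Fin n) ℂ) : Matrix (Fin n) (Fin n) ℂ) :=
  continuous_subtype_val.comp
    (((continuous_apply f4).inv.mul (continuous_apply f5).inv).mul (continuous_apply f6))

/-- **The masked `SU(n)` stout layer is a bijection of `GaugeConfig d L SU(n)`** under the
frozen-staple hypotheses `h1`–`h6`, the frozen-coefficient hypothesis `hR`, and the certificate
`2(d−1)|ρ| < 1` at every active link — every `n`, `d`, `L`. -/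
theorem sunStoutLatticeLayer_bijective (p : Edge d L → Prop) [DecidablePred p]
    (ρ : GaugeConfig d L (Matrix.specialUnitaryGroup (Fin n) ℂ) → Edge d L → ℝ)
    (R : (e : Edge d L) → ({f : Edge d L // ¬p f} → Matrix.specialUnitaryGroup (Fin n) ℂ) → ℝ)
    (hR : ∀ V e, p e → ρ V e = R e (fun f => V f))
    (h1 : ∀ e, p e → ∀ ν, ν ≠ e.2 → ¬p (e.1.shift e.2, ν))
    (h2 : ∀ e, p e → ∀ ν, ν ≠ e.2 → ¬p (e.1.shift ν, e.2))
    (h3 : ∀ e, p e → ∀ ν, ν ≠ e.2 → ¬p (e.1, ν))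
    (h4 : ∀ e, p e → ∀ ν, ν ≠ e.2 → ¬p ((e.1 - Pi.single ν 1).shift e.2, ν))
    (h5 : ∀ e, p e → ∀ ν, ν ≠ e.2 → ¬p (e.1 - Pi.single ν 1, e.2))
    (h6 : ∀ e, p e → ∀ ν, ν ≠ e.2 → ¬p (e.1 - Pi.single ν 1, ν))
    (hκ : ∀ e y, p e → 2 * (d - 1 : ℝ) * |R e y| < 1) :
    Function.Bijective (fun (V : GaugeConfig d L (Matrix.specialUnitaryGroup (Fin n) ℂ)) (e : Edge d L) =>
      if p e then
        (⟨NormedSpace.exp ((ρ V e : ℂ) • suProj (plaquetteLoopSum V e.1 e.2)),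
            exp_smul_suProj_mem (ρ V e) (plaquetteLoopSum V e.1 e.2)⟩ :
          Matrix.specialUnitaryGroup (Fin n) ℂ) * V e
      else V e) := by
  rw [sunStoutLayer_eq_coupleFun p ρ R hR h1 h2 h3 h4 h5 h6]
  exact coupleFun_bijective_of_fibre fun a y => stoutFibre_bijective (R a.1 y) a.1.2
    (fun ν hν => (y ⟨_, h1 a.1 a.2 ν hν⟩ * (y ⟨_, h2 a.1 a.2 ν hν⟩)⁻¹ * (y ⟨_, h3 a.1 a.2 ν hν⟩)⁻¹).2.1)
    (fun ν hν => ((y ⟨_, h4 a.1 a.2 ν hν⟩)⁻¹ * (y ⟨_, h5 a.1 a.2 ν hν⟩)⁻¹ * y ⟨_, h6 a.1 a.2 ν hν⟩).2.1)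
    (hκ a.1 y a.2)

/-- **The masked `SU(n)` stout layer is a HOMEOMORPHISM of `GaugeConfig d L SU(n)`** when, in
addition, the coefficient `R e` depends continuously on the frozen links (constants; conditioners). -/
theorem isHomeomorph_sunStoutLatticeLayer (p : Edge d L → Prop) [DecidablePred p]
    (ρ : GaugeConfig d L (Matrix.specialUnitaryGroup (Fin n) ℂ) → Edge d L → ℝ)
    (R : (e : Edge d L) → ({f : Edge d L // ¬p f} → Matrix.specialUnitaryGroup (Fin n) ℂ) → ℝ)
    (hR : ∀ V e, p e → ρ V e = R e (fun f => V f)) (hRc : ∀ e, p e → Continuous (R e))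
    (h1 : ∀ e, p e → ∀ ν, ν ≠ e.2 → ¬p (e.1.shift e.2, ν))
    (h2 : ∀ e, p e → ∀ ν, ν ≠ e.2 → ¬p (e.1.shift ν, e.2))
    (h3 : ∀ e, p e → ∀ ν, ν ≠ e.2 → ¬p (e.1, ν))
    (h4 : ∀ e, p e → ∀ ν, ν ≠ e.2 → ¬p ((e.1 - Pi.single ν 1).shift e.2, ν))
    (h5 : ∀ e, p e → ∀ ν, ν ≠ e.2 → ¬p (e.1 - Pi.single ν 1, e.2))
    (h6 : ∀ e, p e → ∀ ν, ν ≠ e.2 → ¬p (e.1 - Pi.single ν 1, ν))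
    (hκ : ∀ e y, p e → 2 * (d - 1 : ℝ) * |R e y| < 1) :
    IsHomeomorph (fun (V : GaugeConfig d L (Matrix.specialUnitaryGroup (Fin n) ℂ)) (e : Edge d L) =>
      if p e then
        (⟨NormedSpace.exp ((ρ V e : ℂ) • suProj (plaquetteLoopSum V e.1 e.2)),
            exp_smul_suProj_mem (ρ V e) (plaquetteLoopSum V e.1 e.2)⟩ :
          Matrix.specialUnitaryGroup (Fin n) ℂ) * V e
      else V e) := by
  rw [sunStoutLayer_eq_coupleFun p ρ R hR h1 h2 h3 h4 h5 h6]
  refine isHomeomorph_coupleFun (fun a y => stoutFibre_bijective (R a.1 y) a.1.2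
    (fun ν hν => (y ⟨_, h1 a.1 a.2 ν hν⟩ * (y ⟨_, h2 a.1 a.2 ν hν⟩)⁻¹ * (y ⟨_, h3 a.1 a.2 ν hν⟩)⁻¹).2.1)
    (fun ν hν => ((y ⟨_, h4 a.1 a.2 ν hν⟩)⁻¹ * (y ⟨_, h5 a.1 a.2 ν hν⟩)⁻¹ * y ⟨_, h6 a.1 a.2 ν hν⟩).2.1)
    (hκ a.1 y a.2)) fun a => ?_
  have hc := continuous_stoutFibre (n := n) a.1.2 (hRc a.1 a.2)
    (fun ν hν => continuous_frozenStapleUp p ⟨_, h1 a.1 a.2 ν hν⟩ ⟨_, h2 a.1 a.2 ν hν⟩ ⟨_, h3 a.1 a.2 ν hν⟩)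
    (fun ν hν => continuous_frozenStapleDown p ⟨_, h4 a.1 a.2 ν hν⟩ ⟨_, h5 a.1 a.2 ν hν⟩ ⟨_, h6 a.1 a.2 ν hν⟩)
  exact hc

/-- **… and a measurable equivalence of `GaugeConfig d L SU(n)` whose forward map IS the masked
stout layer**: the learned / constant-`ρ` `SU(N)` stout layers are bijective measurable transport
maps with measurable inverse — every `N`, `d`, `L ≥ 1`. -/
theorem exists_measurableEquiv_sunStoutLatticeLayer [NeZero L] (p : Edge d L → Prop) [DecidablePred p]
    (ρ : GaugeConfig d L (Matrix.specialUnitaryGroup (Fin n) ℂ) → Edge d L → ℝ)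
    (R : (e : Edge d L) → ({f : Edge d L // ¬p f} → Matrix.specialUnitaryGroup (Fin n) ℂ) → ℝ)
    (hR : ∀ V e, p e → ρ V e = R e (fun f => V f)) (hRc : ∀ e, p e → Continuous (R e))
    (h1 : ∀ e, p e → ∀ ν, ν ≠ e.2 → ¬p (e.1.shift e.2, ν))
    (h2 : ∀ e, p e → ∀ ν, ν ≠ e.2 → ¬p (e.1.shift ν, e.2))
    (h3 : ∀ e, p e → ∀ ν, ν ≠ e.2 → ¬p (e.1, ν))
    (h4 : ∀ e, p e → ∀ ν, ν ≠ e.2 → ¬p ((e.1 - Pi.single ν 1).shift e.2, ν))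
    (h5 : ∀ e, p e → ∀ ν, ν ≠ e.2 → ¬p (e.1 - Pi.single ν 1, e.2))
    (h6 : ∀ e, p e → ∀ ν, ν ≠ e.2 → ¬p (e.1 - Pi.single ν 1, ν))
    (hκ : ∀ e y, p e → 2 * (d - 1 : ℝ) * |R e y| < 1) :
    ∃ Ψ : GaugeConfig d L (Matrix.specialUnitaryGroup (Fin n) ℂ) ≃ᵐ
        GaugeConfig d L (Matrix.specialUnitaryGroup (Fin n) ℂ),
      ⇑Ψ = fun (V : GaugeConfig d L (Matrix.specialUnitaryGroup (Fin n) ℂ)) (e : Edge d L) =>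
        if p e then
          (⟨NormedSpace.exp ((ρ V e : ℂ) • suProj (plaquetteLoopSum V e.1 e.2)),
              exp_smul_suProj_mem (ρ V e) (plaquetteLoopSum V e.1 e.2)⟩ :
            Matrix.specialUnitaryGroup (Fin n) ℂ) * V e
        else V e := by
  haveI : SecondCountableTopology (Matrix (Fin n) (Fin n) ℂ) :=
    inferInstanceAs (SecondCountableTopology (Fin n → Fin n → ℂ))
  haveI : SecondCountableTopology (Matrix.specialUnitaryGroup (Fin n) ℂ) :=
    Topology.IsEmbedding.subtypeVal.secondCountableTopology
  rw [sunStoutLayer_eq_coupleFun p ρ R hR h1 h2 h3 h4 h5 h6]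
  refine exists_measurableEquiv_coupleFun (fun a y => stoutFibre_bijective (R a.1 y) a.1.2
    (fun ν hν => (y ⟨_, h1 a.1 a.2 ν hν⟩ * (y ⟨_, h2 a.1 a.2 ν hν⟩)⁻¹ * (y ⟨_, h3 a.1 a.2 ν hν⟩)⁻¹).2.1)
    (fun ν hν => ((y ⟨_, h4 a.1 a.2 ν hν⟩)⁻¹ * (y ⟨_, h5 a.1 a.2 ν hν⟩)⁻¹ * y ⟨_, h6 a.1 a.2 ν hν⟩).2.1)
    (hκ a.1 y a.2)) fun a => ?_
  have hc := continuous_stoutFibre (n := n) a.1.2 (hRc a.1 a.2)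
    (fun ν hν => continuous_frozenStapleUp p ⟨_, h1 a.1 a.2 ν hν⟩ ⟨_, h2 a.1 a.2 ν hν⟩ ⟨_, h3 a.1 a.2 ν hν⟩)
    (fun ν hν => continuous_frozenStapleDown p ⟨_, h4 a.1 a.2 ν hν⟩ ⟨_, h5 a.1 a.2 ν hν⟩ ⟨_, h6 a.1 a.2 ν hν⟩)
  exact hc

/-! ## The engine's direction masks freeze every staple when the phase moves along all other directions -/

/-- **Generalized-checkerboard direction masks freeze all six staple links.**  For the mask
`p (x, μ') ↔ μ' = μ ∧ φ x = c` with an additive phase `φ` satisfying `φ(ν̂) ≠ 0` for every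
`ν ≠ μ`: at an active link `(x, μ)` and `ν ≠ μ`, the links `(x+μ̂,ν)`, `(x,ν)`, `(x+μ̂−ν̂,ν)`,
`(x−ν̂,ν)` are frozen by direction, and `(x+ν̂,μ)`, `(x−ν̂,μ)` because the phase moves by
`±φ(ν̂) ≠ 0`. -/
theorem directionMask_staples_frozen {A : Type*} [AddGroup A] (φ : (Fin d → ZMod L) →+ A) (c : A)
    (μ : Fin d) (hφ : ∀ ν, ν ≠ μ → φ (Pi.single ν 1) ≠ 0) (e : Edge d L) (he : e.2 = μ ∧ φ e.1 = c)
    (ν : Fin d) (hν : ν ≠ e.2) :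
    ¬((e.1.shift e.2, ν).2 = μ ∧ φ (e.1.shift e.2, ν).1 = c) ∧
    ¬((e.1.shift ν, e.2).2 = μ ∧ φ (e.1.shift ν, e.2).1 = c) ∧
    ¬((e.1, ν).2 = μ ∧ φ (e.1, ν).1 = c) ∧
    ¬(((e.1 - Pi.single ν 1).shift e.2, ν).2 = μ ∧ φ ((e.1 - Pi.single ν 1).shift e.2, ν).1 = c) ∧
    ¬((e.1 - Pi.single ν 1, e.2).2 = μ ∧ φ (e.1 - Pi.single ν 1, e.2).1 = c) ∧
    ¬((e.1 - Pi.single ν 1, ν).2 = μ ∧ φ (e.1 - Pi.single ν 1, ν).1 = c) := by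
  have hνμ : ν ≠ μ := fun h => hν (h.trans he.1.symm)
  refine ⟨fun h => hνμ h.1, fun h => ?_, fun h => hνμ h.1, fun h => hνμ h.1, fun h => ?_, fun h => hνμ h.1⟩
  · apply hφ ν hνμ
    have h' : φ (e.1 + Pi.single ν 1) = c := h.2
    rw [map_add, he.2] at h'
    exact add_eq_left.mp h'
  · apply hφ ν hνμ
    have h' : φ (e.1 - Pi.single ν 1) = c := h.2
    rw [map_sub, he.2] at h'
    exact (sub_eq_self.mp h')

end Summit.Ventures.LatticeQCDFlow.Exactness
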